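import Mathlib
import Summits.Ventures.PercRepro2.ZeroEdge
import Summits.Ventures.PercRepro2.HMFStarLeafOCert

/-!
# The faces of the leaf class of class O: `a₃` pendant at `u` with `N(u) ∖ {a₃}` = `{a₁, o}`,
`{a₂, o}` or `{a₁, a₂}` (blind cell PercRepro2, night-1 g9; NIGHT1-G9.md §4)

`HMFStarLeafO.HMF_star_leaf_o` ((HMF) for `a₃` pendant at `u`, `N(u) = {a₁, a₂, o, a₃}`) with the
missing edge at `u` adjoined at weight `0` (`ZeroEdge`) and transported back (`HMF_ext_iff`).
The class `N(u) = {a₁, a₂, a₃}` is NIGHT1-G7 §7's paper theorem («`u` adjacent only to the two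
roots»), now in the kernel.
-/

open scoped Classical

namespace Summit.Ventures.PercRepro2

namespace StarLeafFaces

variable {V : Type*} {E : Type*} [Fintype E] [DecidableEq E] [Fintype V] [DecidableEq V]
  {R : Type*} [Field R] [LinearOrder R] [IsStrictOrderedRing R]

variable (p : E → R) (ends : E → Sym2 V) {f f₁ f₂ f₃ : E} {a₃ u a₁ a₂ o b : V}

omit [Fintype E] [DecidableEq E] [Fintype V] [DecidableEq V] in
/-- The leaf stays a leaf in the extended graph when the new edge avoids it. -/
lemma hleaf_ext {x y : V} (hleaf : ∀ e, a₃ ∈ ends e → e = f) (h3x : a₃ ≠ x) (h3y : a₃ ≠ y) :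
    ∀ e, a₃ ∈ ZeroEdge.ends' ends s(x, y) e → e = some f := by
  intro e he
  cases e with
  | none =>
    rcases Sym2.mem_iff.1 he with h | h
    · exact absurd h h3x
    · exact absurd h h3y
  | some e => rw [hleaf e he]

omit [Fintype E] [DecidableEq E] [Fintype V] [DecidableEq V] in
/-- The star at `u` with the new edge inserted as the second root coin. -/
lemma hstar_ext₂ {y : V} (hstar : ∀ e, u ∈ ends e → e = f ∨ e = f₁ ∨ e = f₃) :
    ∀ e, u ∈ ZeroEdge.ends' ends s(u, y) e → e = some f ∨ e = some f₁ ∨ e = none ∨ e = some f₃ := by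
  intro e he
  cases e with
  | none => exact Or.inr (Or.inr (Or.inl rfl))
  | some e =>
    rcases hstar e he with h | h | h
    · exact Or.inl (by rw [h])
    · exact Or.inr (Or.inl (by rw [h]))
    · exact Or.inr (Or.inr (Or.inr (by rw [h])))

omit [Fintype E] [DecidableEq E] [Fintype V] [DecidableEq V] in
/-- The star at `u` with the new edge inserted as the first root coin. -/
lemma hstar_ext₁ {y : V} (hstar : ∀ e, u ∈ ends e → e = f ∨ e = f₂ ∨ e = f₃) :
    ∀ e, u ∈ ZeroEdge.ends' ends s(u, y) e → e = some f ∨ e = none ∨ e = some f₂ ∨ e = some f₃ := by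
  intro e he
  cases e with
  | none => exact Or.inr (Or.inl rfl)
  | some e =>
    rcases hstar e he with h | h | h
    · exact Or.inl (by rw [h])
    · exact Or.inr (Or.inr (Or.inl (by rw [h])))
    · exact Or.inr (Or.inr (Or.inr (by rw [h])))

omit [Fintype E] [DecidableEq E] [Fintype V] [DecidableEq V] in
/-- The star at `u` with the new edge inserted as the third coin. -/
lemma hstar_ext₃ {y : V} (hstar : ∀ e, u ∈ ends e → e = f ∨ e = f₁ ∨ e = f₂) :
    ∀ e, u ∈ ZeroEdge.ends' ends s(u, y) e → e = some f ∨ e = some f₁ ∨ e = some f₂ ∨ e = none := by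
  intro e he
  cases e with
  | none => exact Or.inr (Or.inr (Or.inr rfl))
  | some e =>
    rcases hstar e he with h | h | h
    · exact Or.inl (by rw [h])
    · exact Or.inr (Or.inl (by rw [h]))
    · exact Or.inr (Or.inr (Or.inl (by rw [h])))

/-- **(HMF) for `a₃` pendant at `u` with `N(u) = {a₁, o, a₃}`** (the `β = 0` face of the leaf class
of class O). -/
theorem HMF_leaf_a1o (hp : IsProbVec p) (hf : ends f = s(a₃, u)) (hf₁ : ends f₁ = s(u, a₁))
    (hf₃ : ends f₃ = s(u, o)) (hleaf : ∀ e, a₃ ∈ ends e → e = f)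
    (hstar : ∀ e, u ∈ ends e → e = f ∨ e = f₁ ∨ e = f₃) (h3u : a₃ ≠ u) (h3o : a₃ ≠ o)
    (h31 : a₃ ≠ a₁) (h32 : a₃ ≠ a₂) (h3b : a₃ ≠ b) (hu1 : u ≠ a₁) (hu2 : u ≠ a₂) (huo : u ≠ o)
    (hub : u ≠ b) (h12 : a₁ ≠ a₂) (h1o : a₁ ≠ o) (h2o : a₂ ≠ o) : HMF p ends o a₁ a₂ a₃ b := by
  rw [← ZeroEdge.HMF_ext_iff p ends s(u, a₂)]
  exact HMFStarLeafO.HMF_star_leaf_o (p := ZeroEdge.p' p) (ends := ZeroEdge.ends' ends s(u, a₂))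
    (ZeroEdge.isProbVec_p' hp) (f := some f) (f₁ := some f₁) (f₂ := none) (f₃ := some f₃) hf hf₁ rfl
    hf₃ (hleaf_ext ends hleaf h3u h32) (hstar_ext₂ ends hstar) h3u h3o h31 h32 h3b hu1 hu2 huo hub
    h12 h1o h2o

/-- **(HMF) for `a₃` pendant at `u` with `N(u) = {a₂, o, a₃}`** (the `α = 0` face). -/
theorem HMF_leaf_a2o (hp : IsProbVec p) (hf : ends f = s(a₃, u)) (hf₂ : ends f₂ = s(u, a₂))
    (hf₃ : ends f₃ = s(u, o)) (hleaf : ∀ e, a₃ ∈ ends e → e = f)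
    (hstar : ∀ e, u ∈ ends e → e = f ∨ e = f₂ ∨ e = f₃) (h3u : a₃ ≠ u) (h3o : a₃ ≠ o)
    (h31 : a₃ ≠ a₁) (h32 : a₃ ≠ a₂) (h3b : a₃ ≠ b) (hu1 : u ≠ a₁) (hu2 : u ≠ a₂) (huo : u ≠ o)
    (hub : u ≠ b) (h12 : a₁ ≠ a₂) (h1o : a₁ ≠ o) (h2o : a₂ ≠ o) : HMF p ends o a₁ a₂ a₃ b := by
  rw [← ZeroEdge.HMF_ext_iff p ends s(u, a₁)]
  exact HMFStarLeafO.HMF_star_leaf_o (p := ZeroEdge.p' p) (ends := ZeroEdge.ends' ends s(u, a₁))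
    (ZeroEdge.isProbVec_p' hp) (f := some f) (f₁ := none) (f₂ := some f₂) (f₃ := some f₃) hf rfl hf₂
    hf₃ (hleaf_ext ends hleaf h3u h31) (hstar_ext₁ ends hstar) h3u h3o h31 h32 h3b hu1 hu2 huo hub
    h12 h1o h2o

/-- **(HMF) for `a₃` pendant at `u` with `N(u) = {a₁, a₂, a₃}`** (`u` adjacent only to the two
roots — NIGHT1-G7 §7, the `r = 0` face). -/
theorem HMF_leaf_a1a2 (hp : IsProbVec p) (hf : ends f = s(a₃, u)) (hf₁ : ends f₁ = s(u, a₁))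
    (hf₂ : ends f₂ = s(u, a₂)) (hleaf : ∀ e, a₃ ∈ ends e → e = f)
    (hstar : ∀ e, u ∈ ends e → e = f ∨ e = f₁ ∨ e = f₂) (h3u : a₃ ≠ u) (h3o : a₃ ≠ o)
    (h31 : a₃ ≠ a₁) (h32 : a₃ ≠ a₂) (h3b : a₃ ≠ b) (hu1 : u ≠ a₁) (hu2 : u ≠ a₂) (huo : u ≠ o)
    (hub : u ≠ b) (h12 : a₁ ≠ a₂) (h1o : a₁ ≠ o) (h2o : a₂ ≠ o) : HMF p ends o a₁ a₂ a₃ b := by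
  rw [← ZeroEdge.HMF_ext_iff p ends s(u, o)]
  exact HMFStarLeafO.HMF_star_leaf_o (p := ZeroEdge.p' p) (ends := ZeroEdge.ends' ends s(u, o))
    (ZeroEdge.isProbVec_p' hp) (f := some f) (f₁ := some f₁) (f₂ := some f₂) (f₃ := none) hf hf₁ hf₂
    rfl (hleaf_ext ends hleaf h3u h3o) (hstar_ext₃ ends hstar) h3u h3o h31 h32 h3b hu1 hu2 huo hub
    h12 h1o h2o

omit [Fintype E] [DecidableEq E] [Fintype V] [DecidableEq V] in
/-- A two-edge star at `u` with the new edge appended as the third coin. -/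
lemma hstar_ext₂₃ {y : V} (hstar : ∀ e, u ∈ ends e → e = f ∨ e = f₁) :
    ∀ e, u ∈ ZeroEdge.ends' ends s(u, y) e → e = some f ∨ e = some f₁ ∨ e = none := by
  intro e he
  cases e with
  | none => exact Or.inr (Or.inr rfl)
  | some e =>
    rcases hstar e he with h | h
    · exact Or.inl (by rw [h])
    · exact Or.inr (Or.inl (by rw [h]))

omit [Fintype E] [DecidableEq E] [Fintype V] [DecidableEq V] in
/-- A two-edge star at `u` with the new edge inserted as the second coin. -/
lemma hstar_ext₂₂ {y : V} (hstar : ∀ e, u ∈ ends e → e = f ∨ e = f₃) :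
    ∀ e, u ∈ ZeroEdge.ends' ends s(u, y) e → e = some f ∨ e = none ∨ e = some f₃ := by
  intro e he
  cases e with
  | none => exact Or.inr (Or.inl rfl)
  | some e =>
    rcases hstar e he with h | h
    · exact Or.inl (by rw [h])
    · exact Or.inr (Or.inr (by rw [h]))

/-- **(HMF) for `a₃` pendant at `u` with `N(u) = {a₁, a₃}`** (the path `a₃ – u – a₁`; the `o = 0`
face of `HMF_leaf_a1o`). -/
theorem HMF_leaf_a1 (hp : IsProbVec p) (hf : ends f = s(a₃, u)) (hf₁ : ends f₁ = s(u, a₁))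
    (hleaf : ∀ e, a₃ ∈ ends e → e = f) (hstar : ∀ e, u ∈ ends e → e = f ∨ e = f₁) (h3u : a₃ ≠ u)
    (h3o : a₃ ≠ o) (h31 : a₃ ≠ a₁) (h32 : a₃ ≠ a₂) (h3b : a₃ ≠ b) (hu1 : u ≠ a₁) (hu2 : u ≠ a₂)
    (huo : u ≠ o) (hub : u ≠ b) (h12 : a₁ ≠ a₂) (h1o : a₁ ≠ o) (h2o : a₂ ≠ o) :
    HMF p ends o a₁ a₂ a₃ b := by
  rw [← ZeroEdge.HMF_ext_iff p ends s(u, o)]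
  exact HMF_leaf_a1o (ZeroEdge.p' p) (ZeroEdge.ends' ends s(u, o)) (ZeroEdge.isProbVec_p' hp)
    (f := some f) (f₁ := some f₁) (f₃ := none) hf hf₁ rfl (hleaf_ext ends hleaf h3u h3o)
    (hstar_ext₂₃ ends hstar) h3u h3o h31 h32 h3b hu1 hu2 huo hub h12 h1o h2o

/-- **(HMF) for `a₃` pendant at `u` with `N(u) = {a₂, a₃}`** (the path `a₃ – u – a₂`). -/
theorem HMF_leaf_a2 (hp : IsProbVec p) (hf : ends f = s(a₃, u)) (hf₂ : ends f₂ = s(u, a₂))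
    (hleaf : ∀ e, a₃ ∈ ends e → e = f) (hstar : ∀ e, u ∈ ends e → e = f ∨ e = f₂) (h3u : a₃ ≠ u)
    (h3o : a₃ ≠ o) (h31 : a₃ ≠ a₁) (h32 : a₃ ≠ a₂) (h3b : a₃ ≠ b) (hu1 : u ≠ a₁) (hu2 : u ≠ a₂)
    (huo : u ≠ o) (hub : u ≠ b) (h12 : a₁ ≠ a₂) (h1o : a₁ ≠ o) (h2o : a₂ ≠ o) :
    HMF p ends o a₁ a₂ a₃ b := by
  rw [← ZeroEdge.HMF_ext_iff p ends s(u, o)]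
  exact HMF_leaf_a2o (ZeroEdge.p' p) (ZeroEdge.ends' ends s(u, o)) (ZeroEdge.isProbVec_p' hp)
    (f := some f) (f₂ := some f₂) (f₃ := none) hf hf₂ rfl (hleaf_ext ends hleaf h3u h3o)
    (hstar_ext₂₃ ends hstar) h3u h3o h31 h32 h3b hu1 hu2 huo hub h12 h1o h2o

/-- **(HMF) for `a₃` pendant at `u` with `N(u) = {o, a₃}`** (the path `a₃ – u – o`; the `α = 0`
face of `HMF_leaf_a1o`). -/
theorem HMF_leaf_o (hp : IsProbVec p) (hf : ends f = s(a₃, u)) (hf₃ : ends f₃ = s(u, o))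
    (hleaf : ∀ e, a₃ ∈ ends e → e = f) (hstar : ∀ e, u ∈ ends e → e = f ∨ e = f₃) (h3u : a₃ ≠ u)
    (h3o : a₃ ≠ o) (h31 : a₃ ≠ a₁) (h32 : a₃ ≠ a₂) (h3b : a₃ ≠ b) (hu1 : u ≠ a₁) (hu2 : u ≠ a₂)
    (huo : u ≠ o) (hub : u ≠ b) (h12 : a₁ ≠ a₂) (h1o : a₁ ≠ o) (h2o : a₂ ≠ o) :
    HMF p ends o a₁ a₂ a₃ b := by
  rw [← ZeroEdge.HMF_ext_iff p ends s(u, a₁)]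
  exact HMF_leaf_a1o (ZeroEdge.p' p) (ZeroEdge.ends' ends s(u, a₁)) (ZeroEdge.isProbVec_p' hp)
    (f := some f) (f₁ := none) (f₃ := some f₃) hf rfl hf₃ (hleaf_ext ends hleaf h3u h31)
    (hstar_ext₂₂ ends hstar) h3u h3o h31 h32 h3b hu1 hu2 huo hub h12 h1o h2o

/-- (HCOV) for `N(u) = {a₁, o, a₃}`. -/
theorem HCov_leaf_a1o (hp : IsProbVec p) (hf : ends f = s(a₃, u)) (hf₁ : ends f₁ = s(u, a₁))
    (hf₃ : ends f₃ = s(u, o)) (hleaf : ∀ e, a₃ ∈ ends e → e = f)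
    (hstar : ∀ e, u ∈ ends e → e = f ∨ e = f₁ ∨ e = f₃) (h3u : a₃ ≠ u) (h3o : a₃ ≠ o)
    (h31 : a₃ ≠ a₁) (h32 : a₃ ≠ a₂) (h3b : a₃ ≠ b) (hu1 : u ≠ a₁) (hu2 : u ≠ a₂) (huo : u ≠ o)
    (hub : u ≠ b) (h12 : a₁ ≠ a₂) (h1o : a₁ ≠ o) (h2o : a₂ ≠ o) : CovForm.HCov p ends o a₁ a₂ a₃ b :=
  HCov_of_HMF p hp ends o a₁ a₂ a₃ b (HMF_leaf_a1o p ends hp hf hf₁ hf₃ hleaf hstar h3u h3o h31 h32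
    h3b hu1 hu2 huo hub h12 h1o h2o)

/-- (HCOV) for `N(u) = {a₂, o, a₃}`. -/
theorem HCov_leaf_a2o (hp : IsProbVec p) (hf : ends f = s(a₃, u)) (hf₂ : ends f₂ = s(u, a₂))
    (hf₃ : ends f₃ = s(u, o)) (hleaf : ∀ e, a₃ ∈ ends e → e = f)
    (hstar : ∀ e, u ∈ ends e → e = f ∨ e = f₂ ∨ e = f₃) (h3u : a₃ ≠ u) (h3o : a₃ ≠ o)
    (h31 : a₃ ≠ a₁) (h32 : a₃ ≠ a₂) (h3b : a₃ ≠ b) (hu1 : u ≠ a₁) (hu2 : u ≠ a₂) (huo : u ≠ o)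
    (hub : u ≠ b) (h12 : a₁ ≠ a₂) (h1o : a₁ ≠ o) (h2o : a₂ ≠ o) : CovForm.HCov p ends o a₁ a₂ a₃ b :=
  HCov_of_HMF p hp ends o a₁ a₂ a₃ b (HMF_leaf_a2o p ends hp hf hf₂ hf₃ hleaf hstar h3u h3o h31 h32
    h3b hu1 hu2 huo hub h12 h1o h2o)

/-- (HCOV) for `N(u) = {a₁, a₂, a₃}`. -/
theorem HCov_leaf_a1a2 (hp : IsProbVec p) (hf : ends f = s(a₃, u)) (hf₁ : ends f₁ = s(u, a₁))
    (hf₂ : ends f₂ = s(u, a₂)) (hleaf : ∀ e, a₃ ∈ ends e → e = f)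
    (hstar : ∀ e, u ∈ ends e → e = f ∨ e = f₁ ∨ e = f₂) (h3u : a₃ ≠ u) (h3o : a₃ ≠ o)
    (h31 : a₃ ≠ a₁) (h32 : a₃ ≠ a₂) (h3b : a₃ ≠ b) (hu1 : u ≠ a₁) (hu2 : u ≠ a₂) (huo : u ≠ o)
    (hub : u ≠ b) (h12 : a₁ ≠ a₂) (h1o : a₁ ≠ o) (h2o : a₂ ≠ o) : CovForm.HCov p ends o a₁ a₂ a₃ b :=
  HCov_of_HMF p hp ends o a₁ a₂ a₃ b (HMF_leaf_a1a2 p ends hp hf hf₁ hf₂ hleaf hstar h3u h3o h31 h32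
    h3b hu1 hu2 huo hub h12 h1o h2o)

end StarLeafFaces

end Summit.Ventures.PercRepro2
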